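import Summits.BirchSwinnertonDyer.Rank1Residual.P2.CongruentNumberSilentEvenFiveThetaDisplay
import Summits.BirchSwinnertonDyer.Rank1Residual.P2.DecompositionsThreePrimes
import HarnessLib

/-!
# Cell «bsd-monsky» (prover-B): route B in the kernel, part 1 — the three-block recursion for `N = 2pq` and
# `(θ − 1)P(N) ∈ g(N)·w + ℤτ(1)` (PROOF-B Lemma 1 and the assembly of Lemma 5) — nothing asserted

HONEST FRAMING (cell `bsd-monsky`, run/shared/lean/pub/bsd-monsky/; README §1): this file asserts NO arithmetic fact; it
is kernel work on the DISPLAYED data. From the displayed `recursion` and `epsSpec` of Tian–Yuan–Zhang §3.1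
(`GenusPointData.Printed`) it computes, for primes `p ≡ 5 (mod 8)`, `q ≡ 3 (mod 4)`:
`recursionIndex (2pq) = {pq}` (`q ≡ 3 (8)`) / `{q}` (`q ≡ 7 (8)`), `recursionIndex (pq) = {p}`, `recursionIndex p = ∅`
— i.e. TYZ's recursion for `N = 2pq` has exactly THREE blocks, `P(N) = Z(N) − i^{e₁}𝓛(2)(Z(pq) − i^{e₂}𝓛(q)Z(p))` with
`e₁` even (type `(7,2)`) and `e₂` odd (type `(5,3)`), resp. TWO blocks `P(N) = Z(N) − i^{e₁}𝓛(2p)Z(q)` (PROOF-B Lemma 1,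
HOME/proof/PROOF-B.md §4) — and then, from the `θ`-package `thetaSpec D θ` of
`P2/CongruentNumberSilentEvenFiveThetaDisplay.lean` ((B1) `(θ−1)Z(N) ∈ g(N)w + ℤτ(1)`, (B2) `θ` fixes `Z(pq)`/`Z(q)`,
(B3) `θZ(p) + Z(p) ∈ ℤτ(1)`, (θ1) `θ(i) = −i` so `θ[i]^k = (−1)^k[i]^kθ`, and `[i]^kτ(1) = τ(1)`):
`(θ − 1)P(N) = g(N)·w + m·τ(1)` (PROOF-B Lemma 5, assembly, §7). The recursion is used EXACTLY (not modulo `2A(ℍ′_N)`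
as in Prop. 3.4: `w` is a `2`-torsion point and would be lost). Consumed by
`P2/CongruentNumberSilentEvenFiveThetaDescent.lean` (Theorem B in the kernel). Nothing booked; no mark moved.

References: HOME/proof/PROOF-B.md §4, §7; [TianYuanZhang2017] §3.1 (p0011 L67–L73), Thm. 3.3 (ε-types, p0011 L49–L51);
[HardyWright2008] §1.3 Thm. 2.
-/

noncomputable section

open scoped Classical

open WeierstrassCurve WeierstrassCurve.Affine Literature.NumberTheory.EllipticCurves
  Literature.NumberTheory.EllipticCurves.TianYuanZhang2017
  Literature.NumberTheory.EllipticCurves.TianYuanZhang2017.W2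

set_option autoImplicit false

namespace Summit.BirchSwinnertonDyer.Rank1Residual.P2

open ThetaDescent

namespace ThetaDescent

variable {n : ℕ}

/-! ## §3 The recursion for `N = 2pq` has three blocks (PROOF-B Lemma 1), from the displayed `recursion` -/

/-- Divisors of `pq` for primes `p, q`. [cite: HardyWright2008, §1.3 Thm. 2] -/
theorem dvd_prime_mul_prime_iff {p q d : ℕ} (hp : p.Prime) (hq : q.Prime) :
    d ∣ p * q ↔ d = 1 ∨ d = p ∨ d = q ∨ d = p * q := by
  constructor
  · intro h
    obtain ⟨y, z, hy, hz, rfl⟩ := dvd_mul.mp h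
    rcases (Nat.dvd_prime hp).mp hy with rfl | rfl <;>
    rcases (Nat.dvd_prime hq).mp hz with rfl | rfl <;> simp
  · rintro (rfl | rfl | rfl | rfl)
    · exact one_dvd _
    · exact Dvd.intro q rfl
    · exact Dvd.intro_left p rfl
    · exact dvd_rfl

/-- `recursionIndex p = ∅` and `recursionIndex q = ∅` for primes (the only divisor `d₀ ≡ 5, 6, 7` is the prime
itself, with cofactor `1`). [cite: TianYuanZhang2017, §3.1 (p0011 L67–L70)] -/
theorem recursionIndex_prime {r : ℕ} (hr : r.Prime) : recursionIndex r = ∅ := by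
  ext d₀
  simp only [recursionIndex, Finset.mem_filter, Nat.mem_divisors, Finset.notMem_empty, iff_false, not_and,
    not_lt]
  rintro ⟨hd, -⟩ h567 _
  rcases (Nat.dvd_prime hr).mp hd with rfl | rfl
  · omega
  · exact (Nat.div_self hr.pos).le

/-- `recursionIndex (pq) = {p}` for primes `p ≡ 5 (mod 8)`, `q ≡ 3 (mod 8)` (`pq ≡ 7`; the pair `(p, q)` has type
`(5, 3)`, the pair `(q, p)` fails `p ≡ 1, 2, 3`). [cite: TianYuanZhang2017, §3.1 (p0011 L67–L70)] -/
theorem recursionIndex_five_mul_three {p q : ℕ} (hp : p.Prime) (hq : q.Prime) (hp5 : p % 8 = 5)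
    (hq3 : q % 8 = 3) : recursionIndex (p * q) = {p} := by
  have hpq : p * q / p = q := Nat.mul_div_cancel_left q hp.pos
  have hqp : p * q / q = p := Nat.mul_div_cancel p hq.pos
  ext d₀
  simp only [recursionIndex, Finset.mem_filter, Nat.mem_divisors, Finset.mem_singleton]
  constructor
  · rintro ⟨⟨hd, -⟩, h567, h123, hgt⟩
    rcases (dvd_prime_mul_prime_iff hp hq).mp hd with rfl | rfl | rfl | rfl
    · omega
    · rfl
    · rw [hqp] at h123; omega
    · rw [Nat.div_self (Nat.mul_pos hp.pos hq.pos)] at hgt; omega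
  · rintro rfl
    refine ⟨⟨Dvd.intro q rfl, Nat.mul_ne_zero hp.ne_zero hq.ne_zero⟩, Or.inl hp5, ?_, ?_⟩
    · rw [hpq]; omega
    · rw [hpq]; exact hq.one_lt

/-- `recursionIndex (2pq)` for primes `p ≡ 5 (mod 8)`, `q ≡ 3 (mod 4)`: `{pq}` if `q ≡ 3 (mod 8)` (type `(7, 2)`),
`{q}` if `q ≡ 7 (mod 8)` (type `(7, 2)` with `d₁ = 2p`) — PROOF-B Lemma 1's enumeration of the divisor pairs.
[cite: TianYuanZhang2017, §3.1 (p0011 L67–L70)] -/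
theorem recursionIndex_two_mul_five_mul {p q : ℕ} (hp : p.Prime) (hq : q.Prime) (hp5 : p % 8 = 5)
    (hq4 : q % 4 = 3) :
    recursionIndex (2 * (p * q)) = if q % 8 = 3 then {p * q} else {q} := by
  have hp2 : p ≠ 2 := by omega
  have hq2 : q ≠ 2 := by omega
  have hne : p ≠ q := fun h => by omega
  have hN0 : 2 * (p * q) ≠ 0 := Nat.mul_ne_zero two_ne_zero (Nat.mul_ne_zero hp.ne_zero hq.ne_zero)
  have e2 : 2 * (p * q) / 2 = p * q := Nat.mul_div_cancel_left (p * q) two_pos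
  have ep : 2 * (p * q) / p = 2 * q := by
    rw [show 2 * (p * q) = p * (2 * q) by ring]; exact Nat.mul_div_cancel_left (2 * q) hp.pos
  have eq' : 2 * (p * q) / q = 2 * p := by
    rw [show 2 * (p * q) = q * (2 * p) by ring]; exact Nat.mul_div_cancel_left (2 * p) hq.pos
  have e2p : 2 * (p * q) / (2 * p) = q := by
    rw [show 2 * (p * q) = (2 * p) * q by ring]; exact Nat.mul_div_cancel_left q (by omega)
  have e2q : 2 * (p * q) / (2 * q) = p := by
    rw [show 2 * (p * q) = (2 * q) * p by ring]; exact Nat.mul_div_cancel_left p (by omega)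
  have epq : 2 * (p * q) / (p * q) = 2 := Nat.mul_div_cancel 2 (Nat.mul_pos hp.pos hq.pos)
  have eN : 2 * (p * q) / (2 * (p * q)) = 1 := Nat.div_self (Nat.pos_of_ne_zero hN0)
  have hpq8 : (p * q) % 8 = if q % 8 = 3 then 7 else 3 := by
    split_ifs with h3
    · rw [Nat.mul_mod, hp5, h3]
    · rw [Nat.mul_mod, hp5, show q % 8 = 7 by omega]
  ext d₀
  simp only [recursionIndex, Finset.mem_filter, Nat.mem_divisors]
  constructor
  · rintro ⟨⟨hd, -⟩, h567, h123, hgt⟩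
    have hd' : d₀ ∣ 2 * p * q := by rwa [mul_assoc]
    rcases (dvd_mul_three_iff Nat.prime_two hp hq).mp hd' with rfl | rfl | rfl | rfl | rfl | rfl | rfl | rfl
    · omega
    · omega
    · rw [ep] at h123; omega
    · -- `d₀ = q`: only for `q ≡ 7 (mod 8)`
      split_ifs with h3
      · omega
      · exact Finset.mem_singleton_self _
    · rw [e2p] at h123; omega
    · rw [e2q] at h123; omega
    · -- `d₀ = pq`: only for `q ≡ 3 (mod 8)`
      split_ifs with h3
      · exact Finset.mem_singleton_self _
      · rw [hpq8, if_neg h3] at h567; omega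
    · rw [show 2 * p * q = 2 * (p * q) by ring, eN] at hgt; omega
  · intro h
    split_ifs at h with h3
    · rw [Finset.mem_singleton] at h
      subst h
      refine ⟨⟨Dvd.intro_left 2 rfl, hN0⟩, ?_, ?_, ?_⟩
      · rw [hpq8, if_pos h3]; omega
      · rw [epq]; omega
      · rw [epq]; omega
    · rw [Finset.mem_singleton] at h
      subst h
      refine ⟨⟨Dvd.intro_left (2 * p) (by ring), hN0⟩, by omega, ?_, ?_⟩
      · rw [eq']; omega
      · rw [eq']; omega

/-- **PROOF-B Lemma 1 (the three-block recursion), Case I `q ≡ 3 (mod 8)`**, from the displayed `recursion` and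
`epsSpec`: `P(N) = Z(N) − i^{e₁}·𝓛(2)·(Z(pq) − i^{e₂}·𝓛(q)·Z(p))` with `e₁` even (type `(7, 2)`) and `e₂` odd
(type `(5, 3)`). [cite: TianYuanZhang2017, §3.1 (p0011 L67–L73), Thm. 3.3 (p0011 L49–L51)] -/
theorem P_eq_three_blocks {p q : ℕ} (hp : p.Prime) (hq : q.Prime) (hp5 : p % 8 = 5) (hq3 : q % 8 = 3)
    (D : GenusPointData (2 * (p * q))) (hrec : D.recursion) (heps : D.epsSpec) :
    ∃ e₁ e₂ : ℕ, Even e₁ ∧ Odd e₂ ∧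
      D.P (2 * (p * q)) = D.Z (2 * (p * q)) -
        cmIPow D.im D.im_sq e₁ (D.scriptL 2 • (D.Z (p * q) - cmIPow D.im D.im_sq e₂ (D.scriptL q • D.Z p))) := by
  have hq4 : q % 4 = 3 := by omega
  have hN0 : 2 * (p * q) ≠ 0 := Nat.mul_ne_zero two_ne_zero (Nat.mul_ne_zero hp.ne_zero hq.ne_zero)
  have hpq7 : (p * q) % 8 = 7 := by rw [Nat.mul_mod, hp5, hq3]
  have epq : 2 * (p * q) / (p * q) = 2 := Nat.mul_div_cancel 2 (Nat.mul_pos hp.pos hq.pos)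
  have hpqp : p * q / p = q := Nat.mul_div_cancel_left q hp.pos
  -- `P(p) = Z(p)`
  have hPp : D.P p = D.Z p := by
    have h := hrec p (Nat.mem_divisors.mpr ⟨Dvd.intro (2 * q) (by ring), hN0⟩) (Or.inl hp5)
    rw [recursionIndex_prime hp, Finset.sum_empty, sub_zero] at h
    exact h
  -- `P(pq) = Z(pq) − i^{e₂}𝓛(q)P(p)`
  have hPpq : D.P (p * q) = D.Z (p * q) - cmIPow D.im D.im_sq (D.eps p q) (D.scriptL q • D.Z p) := by
    have h := hrec (p * q) (Nat.mem_divisors.mpr ⟨Dvd.intro_left 2 rfl, hN0⟩) (Or.inr (Or.inr hpq7))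
    rw [recursionIndex_five_mul_three hp hq hp5 hq3, Finset.sum_singleton, hpqp, hPp] at h
    exact h
  -- `P(N) = Z(N) − i^{e₁}𝓛(2)P(pq)`
  have hPN := hrec (2 * (p * q)) (Nat.mem_divisors_self _ hN0) (Or.inr (Or.inl (by omega)))
  rw [recursionIndex_two_mul_five_mul hp hq hp5 hq4, if_pos hq3, Finset.sum_singleton, epq, hPpq] at hPN
  refine ⟨D.eps (p * q) 2, D.eps p q, ?_, ?_, hPN⟩
  · have h := heps (p * q) 2
    rw [Nat.even_iff]
    by_contra hodd
    have : (p * q) % 8 = 5 ∧ 2 % 8 = 3 := h.mp (by omega)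
    omega
  · exact Nat.odd_iff.mpr ((heps p q).mpr ⟨hp5, hq3⟩)

/-- **PROOF-B Lemma 1, Case II `q ≡ 7 (mod 8)`**: `P(N) = Z(N) − i^{e₁}·𝓛(2p)·Z(q)` with `e₁` even.
[cite: TianYuanZhang2017, §3.1 (p0011 L67–L73), Thm. 3.3 (p0011 L49–L51)] -/
theorem P_eq_two_blocks {p q : ℕ} (hp : p.Prime) (hq : q.Prime) (hp5 : p % 8 = 5) (hq7 : q % 8 = 7)
    (D : GenusPointData (2 * (p * q))) (hrec : D.recursion) (heps : D.epsSpec) :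
    ∃ e₁ : ℕ, Even e₁ ∧
      D.P (2 * (p * q)) = D.Z (2 * (p * q)) - cmIPow D.im D.im_sq e₁ (D.scriptL (2 * p) • D.Z q) := by
  have hq4 : q % 4 = 3 := by omega
  have hpq3 : (p * q) % 8 = 3 := by rw [Nat.mul_mod, hp5, hq7]
  have hN0 : 2 * (p * q) ≠ 0 := Nat.mul_ne_zero two_ne_zero (Nat.mul_ne_zero hp.ne_zero hq.ne_zero)
  have eq' : 2 * (p * q) / q = 2 * p := by
    rw [show 2 * (p * q) = q * (2 * p) by ring]; exact Nat.mul_div_cancel_left (2 * p) hq.pos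
  have hPq : D.P q = D.Z q := by
    have h := hrec q (Nat.mem_divisors.mpr ⟨Dvd.intro_left (2 * p) (by ring), hN0⟩) (Or.inr (Or.inr hq7))
    rw [recursionIndex_prime hq, Finset.sum_empty, sub_zero] at h
    exact h
  have hPN := hrec (2 * (p * q)) (Nat.mem_divisors_self _ hN0) (Or.inr (Or.inl (by omega)))
  rw [recursionIndex_two_mul_five_mul hp hq hp5 hq4, if_neg (by omega), Finset.sum_singleton, eq', hPq] at hPN
  refine ⟨D.eps q (2 * p), ?_, hPN⟩
  have h := heps q (2 * p)
  rw [Nat.even_iff]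
  by_contra hodd
  have : q % 8 = 5 ∧ (2 * p) % 8 = 3 := h.mp (by omega)
  omega

/-- **`(θ − 1)P(N) ∈ g(N)·w + ℤτ(1)`** (PROOF-B Lemma 5, assembly): apply `θ − 1` to the three-block recursion;
the `Z(pq)`/`Z(q)` block is `θ`-fixed and carries an EVEN power of `[i]` (which commutes with `θ` up to that sign),
the `Z(p)` block carries an ODD power of `[i]` and `θZ(p) + Z(p) ∈ ℤτ(1)`, `[i]^kτ(1) = τ(1)`.
[cite: TianYuanZhang2017, §3.1 (p0011 L67–L73)] -/
theorem theta_sub_P_eq {p q : ℕ} (hp : p.Prime) (hq : q.Prime) (hp5 : p % 8 = 5) (hq4 : q % 4 = 3)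
    (D : GenusPointData (2 * (p * q))) (hrec : D.recursion) (heps : D.epsSpec) (θ : D.H ≃ₐ[ℚ] D.H)
    (hθ : thetaSpec D θ) :
    ∃ (w : APoint D.H) (m : ℤ), ((2 : ℕ) • w = 0 ∨ (2 : ℕ) • w = tauOne) ∧ thetaPt D θ w + w = tauOne ∧
      thetaPt D θ (D.P (2 * (p * q))) - D.P (2 * (p * q)) = (gK (2 * (p * q)) : ℤ) • w + m • tauOne := by
  obtain ⟨-, hθi, -, ⟨w, hw2, hww, m₀, hZN⟩, hB2I, hB2II, hB3⟩ := hθ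
  rcases (show q % 8 = 3 ∨ q % 8 = 7 by omega) with hq3 | hq7
  · obtain ⟨e₁, e₂, he₁, he₂, hP⟩ := P_eq_three_blocks hp hq hp5 hq3 D hrec heps
    obtain ⟨m₃, hm₃⟩ := hB3 hq3
    refine ⟨w, m₀ - D.scriptL 2 * D.scriptL q * m₃, hw2, hww, ?_⟩
    set F := cmIPow D.im D.im_sq e₁ with hF
    set G := cmIPow D.im D.im_sq e₂ with hG
    have hθF : ∀ X, thetaPt D θ (F X) = F (thetaPt D θ X) := fun X => by
      rw [hF, thetaPt_cmIPow D θ hθi, he₁.neg_one_pow, one_smul]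
    have hθG : ∀ X, thetaPt D θ (G X) = -G (thetaPt D θ X) := fun X => by
      rw [hG, thetaPt_cmIPow D θ hθi, he₂.neg_one_pow, neg_smul, one_smul]
    have key : F (G (thetaPt D θ (D.Z p))) = m₃ • tauOne - F (G (D.Z p)) := by
      rw [eq_sub_iff_add_eq, ← map_add, ← map_add, hm₃, map_zsmul, map_zsmul, hG, cmIPow_tauOne, hF,
        cmIPow_tauOne]
    have hZN' : thetaPt D θ (D.Z (2 * (p * q))) = (gK (2 * (p * q)) : ℤ) • w + m₀ • tauOne + D.Z (2 * (p * q)) :=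
      eq_add_of_sub_eq hZN
    rw [hP, map_sub, hθF, map_zsmul (thetaPt D θ), map_sub, hB2I hq3, hθG, map_zsmul (thetaPt D θ), hZN']
    simp only [map_zsmul, map_sub, map_neg, key]
    module
  · obtain ⟨e₁, he₁, hP⟩ := P_eq_two_blocks hp hq hp5 hq7 D hrec heps
    refine ⟨w, m₀, hw2, hww, ?_⟩
    have h1 : thetaPt D θ (cmIPow D.im D.im_sq e₁ (D.scriptL (2 * p) • D.Z q)) =
        cmIPow D.im D.im_sq e₁ (D.scriptL (2 * p) • D.Z q) := by
      rw [thetaPt_cmIPow D θ hθi, he₁.neg_one_pow, one_smul, map_zsmul, hB2II hq7]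
    rw [hP, map_sub, h1, sub_sub_sub_cancel_right, hZN]

end ThetaDescent

end Summit.BirchSwinnertonDyer.Rank1Residual.P2

end
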